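import Literature.NumberTheory.EllipticCurves.PeriodIndexKummerPhi
import HarnessLib

/-!
# The level field `K_P = K(E[P*], μ_P)` in the subgroup model (Clark–Sharif §3.3)

`Proofs`-style file (theorems only; no definitions, no named facts) under the provefact seat on
`Literature.NumberTheory.EllipticCurves.ClarkSharif2010_thm2` (Clark–Sharif 2010, Theorem 2).
Clark–Sharif §3.3: *"First, we wish to reduce to Theorem 1, i.e., to the case where `E[P*]` has
trivial Galois module structure. To this end we introduce the splitting field `K_P = K(E[P*])`
of the `P*`-torsion. We will construct classes `θ_n` in `H¹(K_P, E[P])` […], then we will set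
`ξ_n = cores_{K_P/K} θ_n`"* (`P* = P` for `P` odd, `2P` for `P` even; by the Weil pairing
`μ_{P*} ⊆ K_P`).  This file supplies that field in the subgroup model used by the corestriction
(`PeriodIndexCorestriction`) and the Kummer classes `Φ(a, b)` (`PeriodIndexKummerPhi`): an
intermediate field `K ⊆ k ⊆ K̄` whose group `𝔤_k = fixingGal k ≤ 𝔤_K` is **open, normal and of
finite index**, which contains a primitive `P`-th root of unity `ζ`, and such that `𝔤_k` acts
trivially on the `m`-torsion `E[m] = geomTorsion W m` (take `m = P*`).  We take for `k` the normal
closure of the compositum of `K(ζ)` and of finite extensions `L_T` with `Gal(K̄/L_T)` fixing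
`T`, one for each of the finitely many `T ∈ E[m]` (Silverman III.6.4; the stabilisers are open,
`E(K̄)` being a discrete `𝔤_K`-module) — a finite normal extension containing `K(E[m], μ_P)`;
adjoining `μ_P` explicitly spares the Weil pairing.

* `finiteIndex_of_isOpen` — an open subgroup of the compact group `𝔤_K` has finite index;
* `exists_finiteDimensional_forall_smul_eq` — every `T ∈ E(K̄)` is fixed by `Gal(K̄/L)` for
  some finite `L/K`;
* `exists_levelField` — **the level field**: for an elliptic curve `W/K` (`char K = 0`), `m ≠ 0`
  and `P > 0` there is `k` with `fixingGal k` open, normal, of finite index, `k/K` finite and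
  normal, some primitive `P`-th root of unity `ζ ∈ k`, and `n • T = T` for all `n ∈ 𝔤_k`,
  `T ∈ E[m]` — exactly the standing hypotheses `hN`, `[(fixingGal k).Normal]`,
  `[Fintype (𝔤_K ⧸ 𝔤_k)]`, `[Normal K k]`, `hζ`, `hζk`, `htriv` of `PeriodIndexKummerPhi`,
  `PeriodIndexCorestriction(Local)` and `PeriodIndexLocalTriviality`.

## References

* P. L. Clark, S. Sharif, *Period, index and potential Ш*, Algebra & Number Theory 4 (2010)
  151–174, §3.3; arXiv:0811.3019 read. [ClarkSharif2010]
* J. Neukirch, *Algebraic Number Theory* (1999), Ch. IV §1 (Krull topology, Thm. (1.2)).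
  [NeukirchANT1999]
-/

noncomputable section

open scoped Classical IntermediateField

universe u

namespace Literature.NumberTheory.EllipticCurves

open GaloisRepresentations Field

/-! ## Open subgroups of `𝔤_K`; stabilisers of geometric points -/

section AbsGalois

variable {K : Type u} [Field K]

/-- **An open subgroup of `𝔤_K` has finite index** (`char K = 0`: `𝔤_K` is compact, and the
coset space of an open subgroup is discrete; the case `G = 𝔤_K` of
`GaloisRepresentations.finiteIndex_of_isOpen_of_compactSpace` of `EulerSystem`, not imported
here). Serre, *Galois Cohomology*, I.§1.1. [folklore] -/
theorem finiteIndex_of_isOpen [CharZero K] (U : Subgroup (absoluteGaloisGroup K))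
    (hU : IsOpen (U : Set (absoluteGaloisGroup K))) : U.FiniteIndex := by
  haveI : DiscreteTopology (absoluteGaloisGroup K ⧸ U) := QuotientGroup.discreteTopology hU
  haveI : Finite (absoluteGaloisGroup K ⧸ U) := finite_of_compact_of_discrete
  exact Subgroup.finiteIndex_of_finite_quotient

/-- **Every geometric point is fixed by an open subgroup `Gal(K̄/L)`, `L/K` finite**: the
stabiliser of `T ∈ E(K̄)` is open (`E(K̄)` is a discrete `𝔤_K`-module,
`continuousSMul_geomPoints`), hence contains `Gal(K̄/L)` for a finite `L/K` (Krull topology).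
Silverman, *AEC*, VIII.§1; Serre, *Galois Cohomology*, II.§1. [folklore] -/
theorem exists_finiteDimensional_forall_smul_eq (W : WeierstrassCurve K)
    (T : WeierstrassCurve.geomPoints W) :
    ∃ L : IntermediateField K (AlgebraicClosure K), FiniteDimensional K L ∧
      ∀ n ∈ fixingGal L, n • T = T := by
  haveI := WeierstrassCurve.continuousSMul_geomPoints W
  have hopen :
      IsOpen (MulAction.stabilizer (absoluteGaloisGroup K) T : Set (absoluteGaloisGroup K)) :=
    stabilizer_isOpen _ T
  have hnhds : (MulAction.stabilizer (absoluteGaloisGroup K) T : Set (absoluteGaloisGroup K)) ∈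
      nhds (1 : absoluteGaloisGroup K) :=
    hopen.mem_nhds (Subgroup.one_mem _)
  obtain ⟨L, hL, hsub⟩ :=
    (krullTopology_mem_nhds_one_iff K (AlgebraicClosure K) _).mp hnhds
  exact ⟨L, hL, fun n hn ↦ hsub hn⟩

end AbsGalois

/-! ## The level field -/

section LevelField

variable {K : Type u} [Field K] [CharZero K] (W : WeierstrassCurve K) [W.IsElliptic]

/-- **The level field `k = K(E[m], μ_P)` (Clark–Sharif §3.3, `K_P = K(E[P*])`).**  For an
elliptic curve `W` over a field `K` of characteristic `0`, `m ≠ 0` and `P > 0`, there is an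
intermediate field `K ⊆ k ⊆ K̄` such that: `𝔤_k = fixingGal k` is open, normal and of finite
index in `𝔤_K`; `k/K` is finite and normal; `k` contains a primitive `P`-th root of unity; and
`𝔤_k` acts trivially on `E[m] = geomTorsion W m` ("`E[P*]` has trivial Galois module structure"
over `K_P`).  Proof: `k` is the normal closure of the compositum of `K(ζ)` and of finite
extensions `L_T` with `Gal(K̄/L_T)` fixing `T`, `T ∈ E[m]` (finitely many: Silverman III.6.4;
they exist because the stabilisers are open), and Krull's Galois correspondence.
[cite: ClarkSharif2010, §3.3] -/
theorem exists_levelField {m : ℤ} (hm : m ≠ 0) (P : ℕ) [NeZero P] :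
    ∃ k : IntermediateField K (AlgebraicClosure K),
      IsOpen (fixingGal k : Set (absoluteGaloisGroup K)) ∧ (fixingGal k).Normal ∧
      (fixingGal k).FiniteIndex ∧ FiniteDimensional K k ∧ Normal K k ∧
      (∃ ζ : AlgebraicClosure K, IsPrimitiveRoot ζ P ∧ ζ ∈ k) ∧
      ∀ n ∈ fixingGal k, ∀ T ∈ WeierstrassCurve.geomTorsion W m, n • T = T := by
  -- finite extensions fixing each of the finitely many `m`-torsion points
  haveI : Finite (WeierstrassCurve.geomTorsion W m) :=
    WeierstrassCurve.finite_torsionPoints_holds W (AlgebraicClosure K) hm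
  choose L hLfd hLfix using fun T : WeierstrassCurve.geomTorsion W m ↦
    exists_finiteDimensional_forall_smul_eq W (T : WeierstrassCurve.geomPoints W)
  -- a primitive `P`-th root of unity
  haveI : NeZero (P : AlgebraicClosure K) := NeZero.charZero
  obtain ⟨ζ, hζ⟩ := HasEnoughRootsOfUnity.exists_primitiveRoot (AlgebraicClosure K) P
  have hζint : IsIntegral K ζ := Algebra.IsIntegral.isIntegral ζ
  haveI : FiniteDimensional K K⟮ζ⟯ := IntermediateField.adjoin.finiteDimensional hζint
  -- the compositum and its normal closure
  haveI : ∀ T, FiniteDimensional K (L T) := hLfd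
  set L₀ : IntermediateField K (AlgebraicClosure K) := (⨆ T, L T) ⊔ K⟮ζ⟯ with hL₀
  haveI : FiniteDimensional K L₀ := IntermediateField.finiteDimensional_sup _ _
  set k : IntermediateField K (AlgebraicClosure K) :=
    IntermediateField.normalClosure K L₀ (AlgebraicClosure K) with hk
  have hL₀k : L₀ ≤ k := IntermediateField.le_normalClosure L₀
  haveI hkfd : FiniteDimensional K k := normalClosure.is_finiteDimensional K L₀ _
  haveI hknormal : Normal K k := normalClosure.normal K L₀ _
  have hopen : IsOpen (fixingGal k : Set (absoluteGaloisGroup K)) := k.fixingSubgroup_isOpen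
  refine ⟨k, hopen, ?_, finiteIndex_of_isOpen _ hopen, hkfd, hknormal, ⟨ζ, hζ, ?_⟩, ?_⟩
  · haveI : IsGalois K k := ⟨⟩
    exact (InfiniteGalois.normal_iff_isGalois k).mpr this
  · exact hL₀k (le_sup_right (a := ⨆ T, L T) (IntermediateField.mem_adjoin_simple_self K ζ))
  · intro n hn T hT
    have hle : L ⟨T, hT⟩ ≤ k := (le_iSup L ⟨T, hT⟩).trans (le_sup_left.trans hL₀k)
    have hn' : n ∈ fixingGal (L ⟨T, hT⟩) :=
      (IntermediateField.mem_fixingSubgroup_iff (L ⟨T, hT⟩) n).mpr fun x hx ↦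
        smul_eq_self_of_mem_fixingGal hn (hle hx)
    exact hLfix ⟨T, hT⟩ n hn'

end LevelField

end Literature.NumberTheory.EllipticCurves
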